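import Literature.Probability.Percolation.QuadCrossingPerturbations
import Literature.Probability.Percolation.QuadCrossingContinuityEventsProofs
import HarnessLib

/-!
# The interior and the boundary of a crossing event in Schramm–Smirnov's space `ℋ_ℂ`

Topic `Probability/Percolation`; companion of `QuadCrossingSpace.lean` / `QuadCrossingContinuityEvents.lean`
(the space `ℋ_D = QuadConfig D` of closed lower sets of quads with the topology `𝒯_D`, the crossing
events `⊞_Q = crossedEvent Q`, and the named fact `SchrammSmirnov2011_lemma_5_1`: subsequential
scaling limits of critical bond percolation on `δℤ²` give `μ(∂⊞_{Q₀}) = 0`).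

We identify the interior and the boundary of `⊞_{Q₀}` in `(ℋ_ℂ, 𝒯)`:

* `QuadConfig.interior_crossedEvent_eq` — **`int ⊞_{Q₀} = ⋃_{Q > Q₀} ⊞_Q`**: a configuration is
  in the interior of the crossing event iff it crosses some quad strictly harder than `Q₀` (in
  Schramm–Smirnov's order `<`, `Quad.StrictlyDominated`);
* `QuadConfig.frontier_crossedEvent_eq` — **`∂⊞_{Q₀} = {S : Q₀ ∈ S, and Q ∉ S for all Q > Q₀}`**,
  the event "`Q₀` is crossed, but not robustly" of Lemma 5.1.

The inclusion `⋃_{Q > Q₀} ⊞_Q ⊆ int ⊞_{Q₀}` is Schramm–Smirnov's `⊞_{Q''} ⊂ V_{U'} ⊂ ⊞_{Q₀}`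
(proof of Lemma 5.1; `V_{U'}` is open). The converse rests on the **continuity of the action of
plane homeomorphisms on `ℋ_ℂ` at the identity** (`QuadConfig.tendsto_mapHomeomorph_of_tendstoUniformlyOn`:
if `g_i → id` and `g_i⁻¹ → id` uniformly on compact sets then `g_i · S → S` in `𝒯`, checked on
the subbasis `V_U`, `V^Q`) applied to the perturbations of `Quad.exists_perturbations`
(`QuadCrossingPerturbations.lean`): `Q₊(t) = g_t ∘ Q₀` with `g_t = H ∘ A_t⁻¹ ∘ H⁻¹ → id`, so that
`g_t⁻¹ · S → S`; if `S ∈ int ⊞_{Q₀}` then eventually `g_t⁻¹ · S ∈ ⊞_{Q₀}`, i.e. `Q₊(t) ∈ S`, and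
`Q₀ < Q₊(t)`.

Everything is proved; no named fact is introduced. (Motivation: with Lemma 5.1 this describes the
`μ`-null boundary explicitly; it is also the topological input for comparing the discrete
continuity estimate (5.1) with Lemma 5.1 in the converse direction.)

## References

* O. Schramm, S. Smirnov, Ann. Probab. 39 (2011) 1768–1814, arXiv:1101.5820, §1.3 (the space
  `ℋ`, `V_U`, `V^Q`, `⊞_Q`) and §5, proof of Lemma 5.1. [SchrammSmirnov2011]
-/

noncomputable section

open Set Filter Metric
open _root_.Topology
open scoped unitInterval

namespace Literature.Probability.Percolation

namespace QuadCrossing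

/-! ### Uniform closeness of quads -/

namespace Quad

variable {D : Set ℂ}

/-- A pointwise bound gives a bound on the distance of quads. [folklore] -/
theorem dist_le_of_forall {Q Q' : Quad D} {C : ℝ} (hC : 0 ≤ C) (h : ∀ z, dist (Q z) (Q' z) ≤ C) :
    dist Q Q' ≤ C := by
  rw [dist_eq]
  exact (ContinuousMap.dist_le hC).2 h

/-- A strict pointwise bound gives a strict bound on the distance of quads. [folklore] -/
theorem dist_lt_of_forall {Q Q' : Quad D} {C : ℝ} (h : ∀ z, dist (Q z) (Q' z) < C) :
    dist Q Q' < C := by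
  rw [dist_eq]
  exact ContinuousMap.dist_lt_of_nonempty h

end Quad

/-! ### The action of plane homeomorphisms on `ℋ_ℂ` is continuous at the identity -/

namespace QuadConfig

/-- **Continuity of the action of plane homeomorphisms on `ℋ_ℂ` in the homeomorphism, at the
identity.** If `g i → id` and `(g i)⁻¹ → id` uniformly on compact sets along a filter `l`, then
`g i · S → S` in `(ℋ_ℂ, 𝒯)` for every configuration `S`: on the subbasis, `V^P ∋ S` persists
because `S` is closed in `𝒬` and `(g i)⁻¹ ∘ P → P` uniformly, and `V_U ∋ S` persists because for
`Q ∈ S ∩ U`, `g i ∘ Q → Q` stays in the open set `U`. [folklore] -/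
theorem tendsto_mapHomeomorph_of_tendstoUniformlyOn {ι : Type*} {l : Filter ι} (g : ι → ℂ ≃ₜ ℂ)
    (hg : ∀ K : Set ℂ, IsCompact K → TendstoUniformlyOn (fun i z => g i z) id l K)
    (hg' : ∀ K : Set ℂ, IsCompact K → TendstoUniformlyOn (fun i z => (g i).symm z) id l K)
    (S : QuadConfig (univ : Set ℂ)) :
    Tendsto (fun i => S.mapHomeomorph (g i)) l (𝓝 S) := by
  rw [TopologicalSpace.nhds_generateFrom, tendsto_iInf]
  intro V
  rw [tendsto_iInf]
  rintro ⟨hSV, hV⟩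
  rw [tendsto_principal]
  rcases hV with ⟨U, hU, rfl⟩ | ⟨P, rfl⟩
  · -- `V_U`: move a crossed quad of `U` along `g i`
    obtain ⟨Q, hQS, hQU⟩ := hSV
    obtain ⟨r, hr, hball⟩ := Metric.isOpen_iff.1 hU Q hQU
    have hev := (Metric.tendstoUniformlyOn_iff.1 (hg Q.carrier Q.isCompact_carrier)) (r / 2)
      (by positivity)
    refine hev.mono fun i hi => ⟨Q.mapHomeomorph (g i), ?_, hball ?_⟩
    · show Q.mapHomeomorph (g i) ∈ S.mapHomeomorph (g i)
      rw [mem_mapHomeomorph, Quad.mapHomeomorph_symm_mapHomeomorph]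
      exact hQS
    · rw [Metric.mem_ball, dist_comm]
      refine (Quad.dist_le_of_forall (by positivity) fun z => ?_).trans_lt (half_lt_self hr)
      exact (hi (Q z) ⟨z, rfl⟩).le
  · -- `V^P`: `P` stays uncrossed because `S` is closed in `𝒬`
    have hP : P ∉ (S : Set (Quad (univ : Set ℂ))) := hSV
    have hSc : IsClosed (S : Set (Quad (univ : Set ℂ))) := S.2.1
    obtain ⟨r, hr, hball⟩ := Metric.isOpen_iff.1 hSc.isOpen_compl P hP
    have hev := (Metric.tendstoUniformlyOn_iff.1 (hg' P.carrier P.isCompact_carrier)) (r / 2)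
      (by positivity)
    refine hev.mono fun i hi => ?_
    show mapHomeomorph (g i) S ∈ notCrossed P
    intro hmem
    rw [mem_mapHomeomorph] at hmem
    refine hball ?_ hmem
    rw [Metric.mem_ball, dist_comm]
    refine (Quad.dist_le_of_forall (by positivity) fun z => ?_).trans_lt (half_lt_self hr)
    exact (hi (P z) ⟨z, rfl⟩).le

end QuadConfig

/-! ### Conjugating a uniformly small deformation by a plane homeomorphism -/

/-- If `φ i → id` uniformly on the compact set `H⁻¹(K)`, then `H ∘ φ i ∘ H⁻¹ → id` uniformly on
`K` (uniform continuity of `H` on a compact neighbourhood of `H⁻¹(K)`). [folklore] -/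
theorem tendstoUniformlyOn_conj {ι : Type*} {l : Filter ι} (H : ℂ ≃ₜ ℂ) (φ : ι → ℂ → ℂ)
    {K : Set ℂ} (hK : IsCompact K)
    (hφ : TendstoUniformlyOn φ id l (H.symm '' K)) :
    TendstoUniformlyOn (fun i z => H (φ i (H.symm z))) id l K := by
  have hK' : IsCompact (H.symm '' K) := hK.image H.symm.continuous
  have hK'' : IsCompact (cthickening 1 (H.symm '' K)) := hK'.cthickening
  have hHu : UniformContinuousOn H (cthickening 1 (H.symm '' K)) :=
    hK''.uniformContinuousOn_of_continuous H.continuous.continuousOn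
  rw [Metric.tendstoUniformlyOn_iff] at hφ ⊢
  intro ε hε
  obtain ⟨η, hη, hHη⟩ := Metric.uniformContinuousOn_iff.1 hHu ε hε
  filter_upwards [hφ (min η 1) (lt_min hη one_pos)] with i hi z hz
  have hw : H.symm z ∈ H.symm '' K := mem_image_of_mem _ hz
  have hd : dist (H.symm z) (φ i (H.symm z)) < min η 1 := hi (H.symm z) hw
  have hmem : φ i (H.symm z) ∈ cthickening 1 (H.symm '' K) :=
    mem_cthickening_of_dist_le _ (H.symm z) _ _ hw (by rw [dist_comm]; exact (hd.trans_le (min_le_right _ _)).le)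
  have := hHη (H.symm z) (self_subset_cthickening _ hw) (φ i (H.symm z)) hmem
    (hd.trans_le (min_le_left _ _))
  rwa [H.apply_symm_apply] at this

/-! ### The stretches `A_t⁻¹` and `A_t` -/

/-- The stretch `(u + iv) ↦ (a u) + i (b v)` for `a, b > 0`, a homeomorphism of the plane. [folklore] -/
def stretchHomeomorph (a b : ℝ) (ha : 0 < a) (hb : 0 < b) : ℂ ≃ₜ ℂ where
  toFun z := ⟨a * z.re, b * z.im⟩
  invFun z := ⟨z.re / a, z.im / b⟩
  left_inv z := by
    apply Complex.ext <;> simp only <;> field_simp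
  right_inv z := by
    apply Complex.ext <;> simp only <;> field_simp
  continuous_toFun := by
    refine Continuous.comp (g := fun p : ℝ × ℝ => (⟨p.1, p.2⟩ : ℂ))
      (f := fun z : ℂ => (a * z.re, b * z.im)) Complex.equivRealProdCLM.symm.continuous ?_
    fun_prop
  continuous_invFun := by
    refine Continuous.comp (g := fun p : ℝ × ℝ => (⟨p.1, p.2⟩ : ℂ))
      (f := fun z : ℂ => (z.re / a, z.im / b)) Complex.equivRealProdCLM.symm.continuous ?_
    fun_prop

/-- Pointwise formula for the stretch. [folklore] -/
@[simp] theorem stretchHomeomorph_apply (a b : ℝ) (ha : 0 < a) (hb : 0 < b) (z : ℂ) :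
    stretchHomeomorph a b ha hb z = ⟨a * z.re, b * z.im⟩ := rfl

/-- Pointwise formula for the inverse stretch. [folklore] -/
@[simp] theorem stretchHomeomorph_symm_apply (a b : ℝ) (ha : 0 < a) (hb : 0 < b) (z : ℂ) :
    (stretchHomeomorph a b ha hb).symm z = ⟨z.re / a, z.im / b⟩ := rfl

/-- A stretch with factors within `s` of `1` moves points of norm `≤ M` by at most `2 s M`. [folklore] -/
theorem dist_stretch_le {a b s M : ℝ} (ha : 0 < a) (hb : 0 < b) (hsa : |a - 1| ≤ s) (hsb : |b - 1| ≤ s)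
    {w : ℂ} (hw : ‖w‖ ≤ M) : dist w (stretchHomeomorph a b ha hb w) ≤ 2 * s * M := by
  have hs : 0 ≤ s := (abs_nonneg _).trans hsa
  have hM : 0 ≤ M := (norm_nonneg _).trans hw
  rw [dist_eq_norm]
  have hre : |w.re| ≤ M := (Complex.abs_re_le_norm w).trans hw
  have him : |w.im| ≤ M := (Complex.abs_im_le_norm w).trans hw
  have e : w - stretchHomeomorph a b ha hb w = ⟨(1 - a) * w.re, (1 - b) * w.im⟩ := by
    apply Complex.ext <;> simp <;> ring
  rw [e]
  refine (Complex.norm_le_abs_re_add_abs_im _).trans ?_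
  simp only [abs_mul]
  have h1 : |1 - a| ≤ s := by rw [abs_sub_comm]; exact hsa
  have h2 : |1 - b| ≤ s := by rw [abs_sub_comm]; exact hsb
  nlinarith [abs_nonneg (1 - a), abs_nonneg (1 - b), abs_nonneg w.re, abs_nonneg w.im]

/-! ### Stretches close to the identity move compact sets uniformly little -/

/-- Stretches whose factors tend to `1` converge to the identity uniformly on compact sets. [folklore] -/
theorem tendstoUniformlyOn_stretch {ι : Type*} {l : Filter ι} (a b : ι → ℝ) (ha : ∀ i, 0 < a i)
    (hb : ∀ i, 0 < b i) (hla : Tendsto a l (𝓝 1)) (hlb : Tendsto b l (𝓝 1)) {K : Set ℂ}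
    (hK : IsCompact K) :
    TendstoUniformlyOn (fun i w => stretchHomeomorph (a i) (b i) (ha i) (hb i) w) id l K := by
  obtain ⟨M, hM⟩ := hK.isBounded.exists_norm_le
  rw [Metric.tendstoUniformlyOn_iff]
  intro ε hε
  set M' := max M 1 with hM'
  have hM'pos : 0 < M' := lt_of_lt_of_le one_pos (le_max_right _ _)
  have hs : 0 < ε / (4 * M') := by positivity
  filter_upwards [Metric.tendsto_nhds.1 hla _ hs, Metric.tendsto_nhds.1 hlb _ hs] with i hia hib w hw
  have hia' : |a i - 1| ≤ ε / (4 * M') := by rw [← Real.dist_eq]; exact hia.le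
  have hib' : |b i - 1| ≤ ε / (4 * M') := by rw [← Real.dist_eq]; exact hib.le
  refine (dist_stretch_le (ha i) (hb i) hia' hib' ((hM w hw).trans (le_max_left M 1))).trans_lt ?_
  rw [show 2 * (ε / (4 * M')) * M' = ε / 2 from by field_simp; ring]
  linarith

/-- The inverse of a stretch is the stretch with inverse factors, pointwise. [folklore] -/
theorem stretchHomeomorph_symm_apply_eq (a b : ℝ) (ha : 0 < a) (hb : 0 < b) (z : ℂ) :
    (stretchHomeomorph a b ha hb).symm z = stretchHomeomorph a⁻¹ b⁻¹ (inv_pos.2 ha) (inv_pos.2 hb) z := by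
  rw [stretchHomeomorph_symm_apply, stretchHomeomorph_apply]
  apply Complex.ext <;> simp [div_eq_inv_mul]

/-! ### The interior of a crossing event: robustly crossed configurations -/

namespace QuadConfig

/-- **If `S` lies in the interior of `⊞_{Q₀}` then some quad `Q > Q₀` is in `S`.** With `H` a
plane homeomorphism through which `Q₀` is the chart of the square and `Q₊(t) = g_t ∘ Q₀`,
`g_t = H ∘ A_t⁻¹ ∘ H⁻¹` the perturbations of `Quad.exists_perturbations` (`Q₀ < Q₊(t)`), the
configurations `g_t⁻¹ · S` converge to `S` as `t → 0⁺` (`tendsto_mapHomeomorph_of_tendstoUniformlyOn`),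
hence eventually lie in the interior of `⊞_{Q₀}`; and `Q₀ ∈ g_t⁻¹ · S` means `Q₊(t) ∈ S`.
[cite: SchrammSmirnov2011, §1.3 and proof of Lemma 5.1] -/
theorem exists_strictlyDominated_mem_of_mem_interior (Q₀ : Quad (univ : Set ℂ))
    {S : QuadConfig (univ : Set ℂ)} (hS : S ∈ interior (crossedEvent Q₀)) :
    ∃ Q : Quad (univ : Set ℂ), Quad.StrictlyDominated Q₀ Q ∧ Q ∈ S := by
  obtain ⟨H, hH, t₀, ht₀, ht₀', hpert⟩ := Quad.exists_perturbations isOpen_univ Q₀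
  -- the sequence of stretches `A_{t_n}⁻¹`, `t_n = t₀/(n+2) → 0`
  set t : ℕ → ℝ := fun n => t₀ / (n + 2) with ht
  have htpos : ∀ n, 0 < t n := fun n => by positivity
  have htle : ∀ n, t n ≤ t₀ := fun n => by
    rw [ht]; dsimp only
    rw [div_le_iff₀ (by positivity)]
    nlinarith
  have ht1 : ∀ n, t n < 1 := fun n => by linarith [htle n]
  have htlim : Tendsto t atTop (𝓝 0) := by
    have : Tendsto (fun n : ℕ => t₀ / ((n : ℝ) + 2)) atTop (𝓝 0) :=
      tendsto_const_nhds.div_atTop (tendsto_natCast_atTop_atTop.atTop_add tendsto_const_nhds)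
    exact this
  have ha : ∀ n, 0 < (1 - t n)⁻¹ := fun n => inv_pos.2 (by linarith [ht1 n])
  have hb : ∀ n, 0 < (1 + t n)⁻¹ := fun n => inv_pos.2 (by linarith [htpos n])
  set A : ℕ → ℂ ≃ₜ ℂ := fun n => stretchHomeomorph (1 - t n)⁻¹ (1 + t n)⁻¹ (ha n) (hb n) with hA
  set g : ℕ → ℂ ≃ₜ ℂ := fun n => H.symm.trans ((A n).trans H) with hg
  -- `Q₊(t_n) = g_n ∘ Q₀`
  have hQp : ∀ n, ∃ Qp : Quad (univ : Set ℂ), Quad.StrictlyDominated Q₀ Qp ∧ Qp = Q₀.mapHomeomorph (g n) := by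
    intro n
    obtain ⟨Qm, Qp, -, hQpf, -, hlt⟩ := hpert (t n) (htpos n) (htle n)
    refine ⟨Qp, hlt, Quad.ext fun p => ?_⟩
    rw [Quad.mapHomeomorph_apply]
    show Qp.toFun p = (g n) (Q₀.toFun p)
    rw [hQpf p, ← hH p, hg]
    simp only [Homeomorph.trans_apply, Homeomorph.symm_apply_apply, hA, stretchHomeomorph_apply]
    congr 1
    have hre := (Quad.re_im_ofReal_add_ofReal_mul_I (2 * (p.1 : ℝ) - 1) (2 * (p.2 : ℝ) - 1)).1
    have him := (Quad.re_im_ofReal_add_ofReal_mul_I (2 * (p.1 : ℝ) - 1) (2 * (p.2 : ℝ) - 1)).2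
    have hre' := (Quad.re_im_ofReal_add_ofReal_mul_I ((2 * (p.1 : ℝ) - 1) / (1 - t n)) ((2 * (p.2 : ℝ) - 1) / (1 + t n))).1
    have him' := (Quad.re_im_ofReal_add_ofReal_mul_I ((2 * (p.1 : ℝ) - 1) / (1 - t n)) ((2 * (p.2 : ℝ) - 1) / (1 + t n))).2
    apply Complex.ext
    · rw [hre']; change _ = (1 - t n)⁻¹ * Complex.re _; rw [hre, div_eq_inv_mul]
    · rw [him']; change _ = (1 + t n)⁻¹ * Complex.im _; rw [him, div_eq_inv_mul]
  -- `g_n → id`, `g_n⁻¹ → id` uniformly on compact sets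
  have hga : Tendsto (fun n => (1 - t n)⁻¹) atTop (𝓝 1) := by
    have := ((tendsto_const_nhds (x := (1 : ℝ))).sub htlim).inv₀ (by norm_num)
    simpa using this
  have hgb : Tendsto (fun n => (1 + t n)⁻¹) atTop (𝓝 1) := by
    have := ((tendsto_const_nhds (x := (1 : ℝ))).add htlim).inv₀ (by norm_num)
    simpa using this
  have hga' : Tendsto (fun n => ((1 - t n)⁻¹)⁻¹) atTop (𝓝 1) := by simpa using hga.inv₀ one_ne_zero
  have hgb' : Tendsto (fun n => ((1 + t n)⁻¹)⁻¹) atTop (𝓝 1) := by simpa using hgb.inv₀ one_ne_zero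
  have hconv : ∀ K : Set ℂ, IsCompact K → TendstoUniformlyOn (fun n z => (g n).symm z) id atTop K := by
    intro K hK
    have e : (fun n z => (g n).symm z) = fun n z => H ((A n).symm (H.symm z)) := by
      funext n z; rfl
    rw [e]
    refine tendstoUniformlyOn_conj H (fun n w => (A n).symm w) hK ?_
    have e' : (fun n w => (A n).symm w) =
        fun n w => stretchHomeomorph ((1 - t n)⁻¹)⁻¹ ((1 + t n)⁻¹)⁻¹ (inv_pos.2 (ha n)) (inv_pos.2 (hb n)) w := by
      funext n w; exact stretchHomeomorph_symm_apply_eq _ _ _ _ _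
    rw [e']
    exact tendstoUniformlyOn_stretch _ _ _ _ hga' hgb' (hK.image H.symm.continuous)
  have hconv' : ∀ K : Set ℂ, IsCompact K → TendstoUniformlyOn (fun n z => (g n).symm.symm z) id atTop K := by
    intro K hK
    have e : (fun n z => (g n).symm.symm z) = fun n z => H ((A n) (H.symm z)) := by
      funext n z; rfl
    rw [e]
    exact tendstoUniformlyOn_conj H (fun n w => A n w) hK
      (tendstoUniformlyOn_stretch _ _ _ _ hga hgb (hK.image H.symm.continuous))
  -- `g_n⁻¹ · S → S`, hence eventually in the interior of `⊞_{Q₀}`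
  have hlim := tendsto_mapHomeomorph_of_tendstoUniformlyOn (fun n => (g n).symm) hconv hconv' S
  have hev : ∀ᶠ n in atTop, S.mapHomeomorph (g n).symm ∈ interior (crossedEvent Q₀) :=
    hlim (isOpen_interior.mem_nhds hS)
  obtain ⟨n, hn⟩ := hev.exists
  obtain ⟨Qp, hlt, hQp⟩ := hQp n
  refine ⟨Qp, hlt, ?_⟩
  have hmem : S.mapHomeomorph (g n).symm ∈ crossedEvent Q₀ := interior_subset hn
  rw [mem_crossedEvent, mem_mapHomeomorph, Homeomorph.symm_symm] at hmem
  rwa [hQp]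

/-- **Conversely, a configuration containing a quad `Q > Q₀` lies in the interior of `⊞_{Q₀}`**:
the open set `V_U`, `U = {P : Q₀ < P < Q}`, contains `S` (a quad strictly between `Q₀` and `Q`,
`Quad.exists_strictlyDominated_between`, lies in the lower set `S`) and is contained in `⊞_{Q₀}`
(Schramm–Smirnov, proof of Lemma 5.1: `⊞_{Q''} ⊂ V_{U'} ⊂ ⊞_{Q₀}`).
[cite: SchrammSmirnov2011, proof of Lemma 5.1] -/
theorem mem_interior_crossedEvent_of_mem {Q₀ Q : Quad (univ : Set ℂ)} (h : Quad.StrictlyDominated Q₀ Q)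
    {S : QuadConfig (univ : Set ℂ)} (hQ : Q ∈ S) : S ∈ interior (crossedEvent Q₀) := by
  set U : Set (Quad (univ : Set ℂ)) := {P | Quad.StrictlyDominated Q₀ P ∧ Quad.StrictlyDominated P Q}
  have hU : IsOpen U :=
    (Quad.isOpen_setOf_strictlyDominated_right Q₀).inter (Quad.isOpen_setOf_strictlyDominated_left Q)
  refine mem_interior.2 ⟨someCrossed U, ?_, isOpen_someCrossed hU, ?_⟩
  · rintro T ⟨P, hPT, hQ₀P, -⟩
    exact T.isLowerQuadSet hPT hQ₀P
  · obtain ⟨P, hQ₀P, hPQ⟩ := Quad.exists_strictlyDominated_between isOpen_univ h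
    exact ⟨P, S.isLowerQuadSet hQ hPQ, hQ₀P, hPQ⟩

/-- **The interior of the crossing event `⊞_{Q₀}` of `ℋ_ℂ` is the set of robustly crossed
configurations**: `int ⊞_{Q₀} = ⋃_{Q > Q₀} ⊞_Q`. [cite: SchrammSmirnov2011, §1.3 and proof of Lemma 5.1] -/
theorem interior_crossedEvent_eq (Q₀ : Quad (univ : Set ℂ)) :
    interior (crossedEvent Q₀) = ⋃ Q ∈ {Q : Quad (univ : Set ℂ) | Quad.StrictlyDominated Q₀ Q}, crossedEvent Q := by
  ext S
  simp only [mem_iUnion, mem_setOf_eq, mem_crossedEvent, exists_prop]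
  exact ⟨exists_strictlyDominated_mem_of_mem_interior Q₀, fun ⟨Q, hlt, hQ⟩ =>
    mem_interior_crossedEvent_of_mem hlt hQ⟩

/-- **The boundary of `⊞_{Q₀}`** (the event to which Schramm–Smirnov's Lemma 5.1 assigns
probability zero under scaling limits): the configurations crossing `Q₀` but no quad `Q > Q₀`.
[cite: SchrammSmirnov2011, Lemma 5.1 (the event `∂⊞_{Q₀}`)] -/
theorem frontier_crossedEvent_eq (Q₀ : Quad (univ : Set ℂ)) :
    frontier (crossedEvent Q₀) =
      {S | Q₀ ∈ S ∧ ∀ Q : Quad (univ : Set ℂ), Quad.StrictlyDominated Q₀ Q → Q ∉ S} := by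
  rw [(isClosed_crossedEvent Q₀).frontier_eq, interior_crossedEvent_eq]
  ext S
  rw [Set.mem_sdiff, mem_crossedEvent, mem_setOf_eq]
  simp only [mem_iUnion, mem_setOf_eq, mem_crossedEvent, exists_prop, not_exists, not_and]

end QuadConfig

end QuadCrossing

end Literature.Probability.Percolation
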